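import Summits.QuantumFields.YangMills.Theorems.BalabanUVNodesN10B13KernelTowerWalksEntrywiseNumeralsDecoratedRates
import Literature.MathematicalPhysics.QuantumFieldTheory.Balaban1983to89.B13RungDialNumerals

/-!
# BalabanUVNodes ∕ N10 AT THE DECORATED KERNEL TOWER OF RECORD — module 67R's junction of [Balaban1988RG2Cluster] Lemmas 1–3 at the layer `lamD.toC.toK.layer`
# of a DECORATED residual layer `lamD : Node00.ResidB13D θ`, DIALS EDITION: the RUNG's two dials — the accretivity radius `R₁` and the exchange letter `θ₀` —
# FIXED at located numerals (`B13RungDialNumerals.radiusStar`, `B13Bound226Numerals.theta0Max`) and their twelve binders READ AS PRINT's TWO SOURCES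
# (Track A, DAG node N10 [B13]; D-0149 width seat `pub-ymgap-dag-n10-w3` g2, module «67RD» on the lane owner's word; over 67R (n10-w3 g2) = 67 (n10-c g13, p587126)
# + `B13EntrywiseBlockNumerals` (p598246) + `B13RungDialNumerals`)

WHY (lane census `HOME/pub-ymgap-dag-n10-c/N10-RESIDUAL-CENSUS-v15.md`, classes «rung» and «(2.24)–(2.26)»).  In 67R the accretivity radius `R₁` and the exchange
letter `θ₀` are dials coupled to the reference package `rf` and the configuration size `α` by twelve binders (`hR₁ hR₁R hPσ hP₁ hAσ hA₁ hαR`, `hθ₀ hαsmall hRσlarge hθle`,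
with `hp hη` R₁-free in content).  `Literature/…/B13RungDialNumerals` proves that at `R₁ := R₁⋆(rf)` the six radius binders follow from `α ≤ alphaMax θ₀ R₁⋆ K̄`
(monotone in `θ₀`) and the three far-ness binders from `rsigmaMin θ₀ … ≤ R_σ` (antitone in `θ₀`), so that `θ₀ := θ₀max` is the best admissible letter — the key
fact being that `rf.toWalkPackage R₁` reads `R₁` only in its field `R` (`K̄ μ κ_C⋆ B_Γ etaMax` are R₁-free).  THIS FILE is 67R so read: a consumer supplies
`rfl, hp, hη, rfl, hαloc, hRσloc` — print's «|A′|, |𝐉| small» (p. 15) and «σ-cubes sufficiently far» (p. 13) as TWO located inequalities — instead of twelve binders.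

HONEST FRAMING.  Count-neutral kernel bookkeeping BY NAME over LANDED modules (67R + the two numerals files); `lamD.Δ₀ ∕ lamD.J ∕ lamD.Cm ∕ lamD.locF ∕ lamD.P` are
DATA of the layer — NOTHING of Bałaban's `Δ_k`, `G_k(U)`, `Q`, averaging operators is constructed or asserted (NODE 00's reading ∕ N06's Sect.-B road ∕ def-Y own
them); NODE A's ENTRYWISE letters `hEL`, the geodesic letter `hGJ`, `hCle hCsupp`, ONE positivity `hKacc`, the Lemma 1–2 located inputs about the HIDDEN frame
(N09 ∕ N07 ∕ N06 in-edges), the reference package `rf` (NODE O's currency — `RefPackage`, `acrossSmall_of_walks_thresholds` UNTOUCHED; their «for every θ₀ > 0» is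
the dial form) and the numerics REMAIN HYPOTHESES; dag-n10-d's ₁₃ pin algebra (PIN-ALGEBRA ONE-DECLARER) untouched — the conclusion is the Stage-3-keyed
`Node00.B13LeafOfRecord θ lamD.toC.toK.layer` BY NAME.  N10 NOT discharged; K1⁷ NOT closed; counts unmoved; one finite four-torus programme at fixed ε per run;
nothing continuum ∕ ℝ⁴ ∕ OS ∕ mass-gap ∕ Clay.  0 `sorry`, 0 `def`, standard axioms.  Filed `--kind proof --supports` K1⁷ «StabilityBAtRecordR13SepCoPH»
(stmt-QuantumFields-20542) `--as helper` of route «BalabanUVNodes».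

WHAT THIS FILE PROVES.  §1 `b13LeafOfRecord_decLayer_of_located_entrywise_numerals_dials` ⟹ `B13LeafOfRecord θ lamD.toC.toK.layer`.  Generated from 67R's signature
(binders parsed; the twelve replaced; proof = admissibility of `rf.toWalkPackage R₁⋆` + `0 < θ₀max ≤ 1` + `B13RungDialNumerals.rung_dials_at`, then 67R positionally).

References (TYPES and page anchors only): [II] = [Balaban1988RG2Cluster] Lemma 1 p.9, Lemma 2 p.11, Lemma 3 p.20, (1.11) p.5, p.13, p.15, (2.5)–(2.8) pp.12–14,
(2.14)–(2.26) pp.15–17, p.21; [I] = [Balaban1987RG1] (1.11)–(1.14) p.262; [B9] = [Balaban1985BackgroundPropagators] Thm 3.10 (3.107)–(3.108) p.416;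
[Balaban1984PropagatorsII] Lemma 2.1 (2.61) p.234.
A2 ∕ A6 (director-ym №189 STANDING A6 RULE).  The two new located inequalities are jointly inhabited with room at abstract letters
(`B13RungDialNumerals.exists_letters ∕ exists_binders`); 67R's ∕ 67's block-by-block inhabitants stand with the same HONEST LIMITS (no single inhabitant of all
binders at once; the hidden-frame inputs inhabited by the zero tower; `hPa`, `hcount` trivially).  Whether Bałaban's own `rf`, `α`, `R_σ` meet `hαloc hRσloc` is the
located content, NOT claimed.
v1.0.1 (docstring-only edition, 2026-08-28, seat `pub-ymgap-dag-n10-w3` g4; lane census v19 item 4; declarations byte-identical) — ★ VACUITY NOTE (A6,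
dag-n10-w3 g4 `Literature/…/Balaban1983to89/B13CountBinderObstruction`, p612518: `no_joint_inhabitant_of_consts ∕ _constsQ8 ∕ _constsQ8A`,
`count_binders_false_of_delta_kappa_le`): the limit «`hPa`, `hcount` trivially» above is WRONG as hoped — «large `a₅`» is NOT available: `hN` (`Lemma3Numerics`:
`a₅ < c.δ·ℓ·c.κ∕64`) caps `a₅`, and at `Z` = the whole coarse torus with the admissible term `(∅, all bonds)` the θ-FREE count `hcount` ∧ `hPcard` ∧ `hN` force
`1280·(m₃+1)⁴·(ℓ₆+1)³ < c.δ·c.κ`, which EVERY constants family typed in the tree violates (`δκ < 672` for `consts`, `constsQ8 M`, `constsQ8A M α₄`; the odd-L family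
`constsOddL L M α₄` of `B13ChainJointNonvacuityOddL` keeps `δ = δw`, `κ = κw`, so the same bound applies).  Hence the binder set of THIS file (as of 64 ∕ 67 ∕ 67R ∕ 67RDL,
which display the same three binders) has NO joint inhabitant at the tree's constants families — the theorem is TRUE AS STATED (an implication), its hypothesis
list is not jointly satisfiable there, and it must not be read as evidence that the N10 junction is met.  The artefact is module 64's adoption of
`B13Bound226Numerals.vol_of_counts`' θ-free CONCLUSION as a binder (worst-case per-row-bond cost frozen in); print's p. 20 count is dial-weighted («O(1)(LM)⁴α₅»,
α₅ small), met for any object sizes by small `θ₀ ∕ γ₂ ∕ α₄M⁻⁴` (`B13CountBinderObstruction.dialCount_le_of_dials`).  THE DISPLAY OF RECORD of the N10 junction is the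
dial-weighted sibling 67V `…EntrywiseNumeralsDecoratedDialsLocatedVol` (p614443; `hcount ↦ hvol`, `θ₀ ≤ θ₀max` free; lane word INBOX l.31366) ∕ 67VL `…VolDials`
(p619692), whose hypothesis list IS jointly inhabited: `BalabanUVNodesN10B13BondTowerInhabited.b13LeafOfRecord_inhabited` (p625168) — for every Stage-3′ record with
`8 ≤ θ.ℓ₆ + 1`, `∃ lamD : ResidB13D θ, B13LeafOfRecord θ lamD.toC.toK.layer` (the bond tower of `Node00/CarriersB13BondTower` at `constsOddL (θ.ℓ₆+1) (κw+1) α₄`, via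
`…BondTowerReduced` p621116 + `B13ChainJointNonvacuityPrefactorsVol.junction_numerals_joint_witness_vol` p623490).  Nothing of Bałaban's asserted by this note;
count-neutral; N10 NOT discharged.
-/

noncomputable section

namespace Summit.QuantumFields.YangMills.BalabanUVNodes.N10B13KernelTowerWalksEntrywiseNumeralsDecoratedDials

open Literature.MathematicalPhysics.QuantumFieldTheory.Balaban1983to89
open Literature.MathematicalPhysics.QuantumFieldTheory.Balaban1983to89.DagBinding
open Literature.MathematicalPhysics.QuantumFieldTheory.Balaban1983to89.Node00
open Literature.MathematicalPhysics.QuantumFieldTheory.Balaban1983to89.B13Lemma3Torus (TwoTorusStep)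
open Literature.MathematicalPhysics.QuantumFieldTheory.Balaban1983to89.B13Lemma3TorusSocket (TermDomination Lemma3Numerics)
open Literature.MathematicalPhysics.QuantumFieldTheory.Balaban1983to89.B13Lemma3TorusData
open Metric
open Literature.MathematicalPhysics.QuantumFieldTheory.Balaban1983to89.B16Absorption (pbox)
open Literature.MathematicalPhysics.QuantumFieldTheory.Balaban1983to89.TreeLengthTorus
open Literature.MathematicalPhysics.QuantumFieldTheory.Balaban1983to89.TreeLengthTorusGeometry
open Literature.MathematicalPhysics.QuantumFieldTheory.Balaban1983to89.TreeLengthTorusTransfer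
open Literature.MathematicalPhysics.QuantumFieldTheory.Balaban1983to89.B12TreeDecay (kappa₀ K₀)
open Literature.MathematicalPhysics.QuantumFieldTheory.Balaban1983to89.B13PkScaling (Qop scaled)
open Literature.MathematicalPhysics.QuantumFieldTheory.Balaban1983to89.B13Bound143 (invTau R12)
open Literature.MathematicalPhysics.QuantumFieldTheory.Balaban1983to89.B13Term214 (term214 SepHolOn core214 F214)
open Literature.MathematicalPhysics.QuantumFieldTheory.Balaban1983to89.B13Lemma3TorusTerms (terms Z0)
open Literature.MathematicalPhysics.QuantumFieldTheory.Balaban1983to89.B5TorusCover (UT)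
open Literature.MathematicalPhysics.QuantumFieldTheory.Balaban1983to89.B13TermWalkData (TermKernels)
open Literature.MathematicalPhysics.QuantumFieldTheory.Balaban1983to89.NodeOLettersOfWalksAcross (WalkPackage TermWalks)
open Literature.MathematicalPhysics.QuantumFieldTheory.Balaban1983to89.NodeOLettersOfWalksPerturbative (RefPackage TermWalksRef)
open Literature.MathematicalPhysics.QuantumFieldTheory.Balaban1983to89.B13Sqrt27Accretive (invSqrt)
open Literature.MathematicalPhysics.QuantumFieldTheory.Balaban1983to89.B9Thm37GlueTorus (tdist1)
open Literature.MathematicalPhysics.QuantumFieldTheory.Balaban1983to89.B13Eq111SDecoupling (sDecorate)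
open Literature.MathematicalPhysics.QuantumFieldTheory.Balaban1983to89.B13EntrywiseWalks (RawEntryLetters GeodesicDecoration rawEntryTerm)
open Summit.QuantumFields.YangMills.BalabanUVNodes.N10AtRecord11B13WalksBlockEntrywise (b13LeafOfRecord_of_located_entrywise)
open Summit.QuantumFields.YangMills.BalabanUVNodes.N10B13KernelTowerWalksHolo (measurable_chiY₀)
open scoped Matrix
open Summit.QuantumFields.YangMills.BalabanUVNodes.N10B13KernelTowerWalksEntrywiseNumerals (b13LeafOfRecord_layer_of_located_entrywise_numerals)
open Literature.MathematicalPhysics.QuantumFieldTheory.Balaban1983to89.B13Bound226Numerals (theta0Max gamma2Max m4Min)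
open Literature.MathematicalPhysics.QuantumFieldTheory.Balaban1983to89.B13EntrywiseBlockNumerals (kbarFloor numerals_nodeA_of_dials)
open Literature.MathematicalPhysics.QuantumFieldTheory.Balaban1983to89.B13RungDialNumerals (radiusStar alphaMax rsigmaMin radiusStar_pos rung_dials_at)
open Literature.MathematicalPhysics.QuantumFieldTheory.Balaban1983to89.B13Bound226Numerals (theta0Max_pos coefQ_nonneg coefQ'_nonneg dSum_pos_and_le)
open Literature.MathematicalPhysics.QuantumFieldTheory.Balaban1983to89.NodeOLettersOfWalksAcross.WalkPackage (kapCStar_spec rhoE_pos mu_pos Kbar_nonneg)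
open Literature.MathematicalPhysics.QuantumFieldTheory.Balaban1983to89.NodeOLettersOfWalksPerturbative.RefPackage (admissible_toWalkPackage cV_nonneg cV₀_nonneg)
open Summit.QuantumFields.YangMills.BalabanUVNodes.N10B13KernelTowerWalksEntrywiseNumeralsDecoratedRates
  (b13LeafOfRecord_decLayer_of_located_entrywise_numerals_rates)
open Summit.QuantumFields.YangMills.BalabanUVNodes.N10B13KernelTowerWalksEntrywiseNumeralsDecorated
  (b13LeafOfRecord_decLayer_of_located_entrywise_numerals)

/-! ## §1. THE ENTRYWISE-WITH-LOCATED-NUMERALS JUNCTION AT THE DECORATED TOWER, DIALS EDITION — rates budgeted (67R) and the rung's dials `R₁ θ₀` located -/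

section DecLayer

variable (θ : Stage3Params) (lamD : ResidB13D θ)

-- the junction elaborates ≈ 150 binders and a 160–170-argument application; twice the default budget (as the source junction)
set_option maxHeartbeats 400000 in
open Classical in
/-- **THE [B13] LEAF AT THE DECORATED KERNEL TOWER OF RECORD (ENTRYWISE-WITH-LOCATED-NUMERALS, DIALS EDITION).**  Module 67R's
`b13LeafOfRecord_decLayer_of_located_entrywise_numerals_rates` with the rung's two DIALS fixed at located numerals — the accretivity radius
`R₁ = radiusStar rf.R rf.m₀ rf.mA₀ rf.KbarP rf.KbarA rf.cV rf.cV₀` (`B13RungDialNumerals`) and the exchange letter `θ₀ = theta0Max …` (`B13Bound226Numerals`), both as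
EQUATION binders (`rfl`) — and the TWELVE binders `hR₁ hR₁R hPσ hP₁ hAσ hA₁ hαR hθ₀ hαsmall hRσlarge hθle` REPLACED by PRINT's TWO SOURCES as two located inequalities:
`hαloc : α ≤ alphaMax θ₀ R₁ K̄` («|A′|, |𝐉| small», [II] p. 15) and `hRσloc : rsigmaMin θ₀ K̄ μ κ_C⋆ m₀ m_{A,0} K̄_P K̄_A c_V c_V₀ ε_P ε_A ≤ rf.Rσ` («σ-cubes far from Z₀», p. 13);
`hp hη` kept (positive input rates, admissible volume rate — `rf`'s own letters, R₁-free in content).  LOSSLESS up to the choice of `R₁` (any admissible radius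
works; `R₁⋆` is one) and WITHOUT LOSS in `θ₀` (`B13RungDialNumerals.located_at_thetaMax_of_located`).  Every other binder VERBATIM 67R's, in its order;
conclusion `B13LeafOfRecord θ lamD.toC.toK.layer` BY NAME.  Count-neutral: hypotheses about the HIDDEN frame and the letters of the record's own object data;
nothing of Bałaban's is asserted.
[cite: Balaban1988RG2Cluster, Lemma 1 p.9, Lemma 2 p.11, Lemma 3 p.20, p.13, p.15, (2.5)–(2.8) pp.12–14, (2.14)–(2.26) pp.15–17; Balaban1987RG1, (1.11)–(1.14) p.262;
Balaban1985BackgroundPropagators, Thm 3.10 (3.107)–(3.108) p.416; Balaban1984PropagatorsII, Lemma 2.1 (2.61) p.234] -/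
theorem b13LeafOfRecord_decLayer_of_located_entrywise_numerals_dials
    (hN12 : 12 ≤ (θ.ℓ₆ + 1) * (lamD.toC.toK.layer.n + 1))
    -- (1) LEMMA 1: [I]'s block geometry of the (1.33) index families of the layer
    (dist : TDom 4 ((θ.ℓ₆ + 1) * (lamD.toC.toK.layer.n + 1)) → TPt 4 ((θ.ℓ₆ + 1) * (lamD.toC.toK.layer.n + 1)) → (j : ℕ) →
      TPt 4 ((θ.ℓ₆ + 1) ^ (lamD.toC.toK.layer.k - j) * ((θ.ℓ₆ + 1) * (lamD.toC.toK.layer.n + 1))) → ℝ)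
    {K K' : ℝ}
    (hS0Y : ∀ Y, ∀ a ∈ lamD.toC.toK.layer.S0 Y,
      (pbox (fun i => natLift a i - (5 : ℕ)) (fun i => natLift a i + 1 + (5 : ℕ))).image (proj ((θ.ℓ₆ + 1) * (lamD.toC.toK.layer.n + 1))) ⊆ Y.1)
    (hFsub : ∀ Y a, lamD.toC.toK.layer.F Y a ⊆
      (pbox (fun i => natLift a i - (5 : ℕ)) (fun i => natLift a i + 1 + (5 : ℕ))).image (proj ((θ.ℓ₆ + 1) * (lamD.toC.toK.layer.n + 1))) \
        (pbox (fun i => natLift a i - (4 : ℕ)) (fun i => natLift a i + 1 + (4 : ℕ))).image (proj ((θ.ℓ₆ + 1) * (lamD.toC.toK.layer.n + 1))))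
    (hSq : ∀ Y, ∀ a ∈ lamD.toC.toK.layer.S0 Y, ∀ j, lamD.toC.toK.layer.Sq Y a j ⊆
      (Finset.univ : Finset (TPt 4 ((θ.ℓ₆ + 1) ^ (lamD.toC.toK.layer.k - j) * ((θ.ℓ₆ + 1) * (lamD.toC.toK.layer.n + 1))))).filter
        (fun q => tcoarse ((θ.ℓ₆ + 1) ^ (lamD.toC.toK.layer.k - j)) ((θ.ℓ₆ + 1) * (lamD.toC.toK.layer.n + 1)) q ∈
          (pbox (fun i => natLift a i - (2 : ℕ)) (fun i => natLift a i + 1 + (2 : ℕ))).image (proj ((θ.ℓ₆ + 1) * (lamD.toC.toK.layer.n + 1)))))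
    (hScY : ∀ Y, lamD.toC.toK.layer.Sc Y ⊆ Y.1) (hdist0 : ∀ Y a j q, 0 ≤ lamD.toC.toK.layer.c.δ₀ * dist Y a j q)
    (hdist : ∀ Y a j (n : ℕ) q, q ∉ (pbox (fun i => (((θ.ℓ₆ + 1) ^ (lamD.toC.toK.layer.k - j) : ℕ) : ℤ) * natLift a i - (n + 1 : ℕ))
      (fun i => (((θ.ℓ₆ + 1) ^ (lamD.toC.toK.layer.k - j) : ℕ) : ℤ) * natLift a i + 2 * (((θ.ℓ₆ + 1) ^ (lamD.toC.toK.layer.k - j) : ℕ) : ℤ) - 1 + (n + 1 : ℕ))).image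
        (proj ((θ.ℓ₆ + 1) ^ (lamD.toC.toK.layer.k - j) * ((θ.ℓ₆ + 1) * (lamD.toC.toK.layer.n + 1)))) → lamD.toC.toK.layer.c.δ₀ * lamD.toC.toK.layer.c.M * ((n : ℝ) + 1) ≤ lamD.toC.toK.layer.c.δ₀ * dist Y a j q)
    (hSX : ∀ Y a j q, lamD.toC.toK.layer.SX Y a j q ⊆ (tcubeSys 4 ((θ.ℓ₆ + 1) ^ (lamD.toC.toK.layer.k - j) * ((θ.ℓ₆ + 1) * (lamD.toC.toK.layer.n + 1)))).above q)
    (hSX' : ∀ Y a j q, lamD.toC.toK.layer.SX' Y a j q ⊆ (tcubeSys 4 ((θ.ℓ₆ + 1) ^ (lamD.toC.toK.layer.k - j) * ((θ.ℓ₆ + 1) * (lamD.toC.toK.layer.n + 1)))).above q)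
    (hX0 : ∀ Y, ∀ a ∈ lamD.toC.toK.layer.Sc Y, ∀ j ∈ Finset.range (lamD.toC.toK.layer.k + 1), ∀ q ∈ lamD.toC.toK.layer.Sq' Y a j, ∀ x ∈ lamD.toC.toK.layer.SX' Y a j q,
      x.1.image (tcoarse ((θ.ℓ₆ + 1) ^ (lamD.toC.toK.layer.k - j)) ((θ.ℓ₆ + 1) * (lamD.toC.toK.layer.n + 1))) ⊆ Y.1)
    -- (1) LEMMA 1: per-term analyticity on (1.34)
    (hAnT : ∀ Y, ∀ a ∈ lamD.toC.toK.layer.S0 Y, ∀ X ∈ (lamD.toC.toK.layer.F Y a).powerset, ∀ j ∈ Finset.range (lamD.toC.toK.layer.k + 1), ∀ q ∈ lamD.toC.toK.layer.Sq Y a j,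
      ∀ x ∈ lamD.toC.toK.layer.SX Y a j q, AnalyticOnNhd ℂ (lamD.toC.toK.layer.T Y a X j q x) (lamD.toC.toK.layer.sp1 Y))
    (hAnT' : ∀ Y, ∀ a ∈ lamD.toC.toK.layer.Sc Y, ∀ j ∈ Finset.range (lamD.toC.toK.layer.k + 1), ∀ q ∈ lamD.toC.toK.layer.Sq' Y a j, ∀ x ∈ lamD.toC.toK.layer.SX' Y a j q,
      AnalyticOnNhd ℂ (lamD.toC.toK.layer.T' Y a j q x) (lamD.toC.toK.layer.sp1 Y))
    -- (1) LEMMA 1: thresholds and restrictions on the residual constants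
    (hK : 0 ≤ K) (hK' : 0 ≤ K') (hκ : 0 ≤ lamD.toC.toK.layer.c.κ) (hδ1 : lamD.toC.toK.layer.c.δ < 1)
    (hδκ : 1 ≤ lamD.toC.toK.layer.c.δ * lamD.toC.toK.layer.c.κ) (hκ126 : kappa₀ 64 8 ≤ lamD.toC.toK.layer.c.κ)
    (hκ126' : kappa₀ 64 8 ≤ lamD.toC.toK.layer.c.δ * lamD.toC.toK.layer.c.κ) (hκ₁ : 1 + 2 * Real.log (8 * 12 ^ 3) ≤ lamD.toC.toK.layer.c.κ₁)
    (hκ₁' : 2 + 16 * Real.log 128 ≤ lamD.toC.toK.layer.c.κ₁) (hδ₀M : 10 * Real.exp (-1) ≤ lamD.toC.toK.layer.c.δ₀ * lamD.toC.toK.layer.c.M)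
    (hδ₀M5 : 2 * Real.log 5 ≤ lamD.toC.toK.layer.c.δ₀ * lamD.toC.toK.layer.c.M)
    (hR8 : (1 - lamD.toC.toK.layer.c.δ) * lamD.toC.toK.layer.c.κ ≤ (1 / 4) * (lamD.toC.toK.layer.c.κ₁ - 1))
    (hR9 : (1 - 2 * lamD.toC.toK.layer.c.δ) * lamD.toC.toK.layer.c.κ ≤ (1 / 16) * lamD.toC.toK.layer.c.κ₁)
    -- (1) LEMMA 1: per-term (1.24), (1.30) by reference to [I] (3.54), (3.17), [15] Prop. 4, [13] (3.108); the constants with headroom (1 − θ₁)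
    (h124 : ∀ Y φ, φ ∈ lamD.toC.toK.layer.sp1 Y → ∀ a ∈ lamD.toC.toK.layer.S0 Y, ∀ X ∈ (lamD.toC.toK.layer.F Y a).powerset, ∀ j ∈ Finset.range (lamD.toC.toK.layer.k + 1), ∀ q ∈ lamD.toC.toK.layer.Sq Y a j,
      ∀ x ∈ lamD.toC.toK.layer.SX Y a j q,
        ‖lamD.toC.toK.layer.T Y a X j q x φ‖ ≤ K * (((θ.ℓ₆ + 1 : ℕ) : ℝ) ^ j * (((θ.ℓ₆ + 1 : ℕ) : ℝ) ^ lamD.toC.toK.layer.k)⁻¹) ^ 5 *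
          Real.exp (-(lamD.toC.toK.layer.c.κ₁ - 1) *
            (((Y.1 \ (pbox (fun i => natLift a i - (5 : ℕ)) (fun i => natLift a i + 1 + (5 : ℕ))).image
              (proj ((θ.ℓ₆ + 1) * (lamD.toC.toK.layer.n + 1)))).card : ℝ) + X.card)) *
          Real.exp (-(lamD.toC.toK.layer.c.κ * torusTreeLen x.1)))
    (h130 : ∀ Y φ, φ ∈ lamD.toC.toK.layer.sp1 Y → ∀ a ∈ lamD.toC.toK.layer.Sc Y, ∀ j ∈ Finset.range (lamD.toC.toK.layer.k + 1), ∀ q ∈ lamD.toC.toK.layer.Sq' Y a j,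
      ∀ x ∈ lamD.toC.toK.layer.SX' Y a j q,
        ‖lamD.toC.toK.layer.T' Y a j q x φ‖ ≤ K' * Real.exp (-(1 / 2) * (lamD.toC.toK.layer.c.δ₀ * lamD.toC.toK.layer.c.M) * (((θ.ℓ₆ + 1 : ℕ) : ℝ) ^ j * (((θ.ℓ₆ + 1 : ℕ) : ℝ) ^ lamD.toC.toK.layer.k)⁻¹)⁻¹
            - (1 / 2) * lamD.toC.toK.layer.c.δ₀ * dist Y a j q) *
          Real.exp (-(lamD.toC.toK.layer.c.κ₁ - 1) * ((Y.1 \ x.1.image (tcoarse ((θ.ℓ₆ + 1) ^ (lamD.toC.toK.layer.k - j)) ((θ.ℓ₆ + 1) * (lamD.toC.toK.layer.n + 1)))).card : ℝ)) *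
          Real.exp (-(lamD.toC.toK.layer.c.κ * torusTreeLen x.1)))
    {θ₁ : ℝ} (hθ₁0 : 0 ≤ θ₁) (hθ₁1 : θ₁ < 1)
    (hC : K * K₀ 64 8 * (2 * (6 * ((θ.ℓ₆ + 1 : ℕ) : ℝ)) ^ 4) * Real.exp 1 * Real.exp ((1 / 8) * lamD.toC.toK.layer.c.κ₁ * (12 ^ 4 - 1)) +
        2 * (64 * K') * K₀ 64 8 * 1344 ≤
      (1 - θ₁) * (lamD.toC.toK.layer.c.E₀ * lamD.toC.toK.layer.c.ε₁ * lamD.toC.toK.layer.c.C₁ * lamD.toC.toK.layer.c.M ^ lamD.toC.toK.layer.c.q * Real.exp (lamD.toC.toK.layer.c.C₂ * lamD.toC.toK.layer.c.κ₁)))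
    -- (2) LEMMA 2 (pp. 10–11): the curvature terms; the located per-term data of `B13Lemma2Torus.lemma2Printed_twoTorus'` for the layer's plaquette data
    (hGlAn : ∀ Y, AnalyticOnNhd ℂ (lamD.toC.toK.layer.Gl Y) (lamD.toC.toK.layer.sp1 Y))
    (hGl : ∀ Y φ, φ ∈ lamD.toC.toK.layer.sp1 Y → ‖lamD.toC.toK.layer.Gl Y φ‖ ≤ θ₁ * (lamD.toC.toK.layer.c.E₀ * lamD.toC.toK.layer.c.ε₁ * lamD.toC.toK.layer.c.C₁ * lamD.toC.toK.layer.c.M ^ lamD.toC.toK.layer.c.q * Real.exp (lamD.toC.toK.layer.c.C₂ * lamD.toC.toK.layer.c.κ₁)) *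
      Real.exp (-((1 - 2 * lamD.toC.toK.layer.c.δ) * lamD.toC.toK.layer.c.κ * (tsys 4 ((θ.ℓ₆ + 1) * (lamD.toC.toK.layer.n + 1))).dj Y)))
    (he : ∀ Y b, ‖lamD.toC.toK.layer.e Y b‖ ≤ 1) (hg : lamD.toC.toK.layer.g ≠ 0) {R K₂ : ℝ} {m₂ : ℕ} (hK₂ : 0 ≤ K₂) (hR : 0 < R)
    (hε3 : 3 * lamD.toC.toK.layer.c.ε₁ ≤ R)
    (hW : ∀ Y, ∀ i ∈ lamD.toC.toK.layer.s Y, ∀ φ ∈ lamD.toC.toK.layer.sp1 Y, AnalyticOnNhd ℂ (lamD.toC.toK.layer.Wf Y i φ) (ball 0 R))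
    (hKW : ∀ Y, ∀ i ∈ lamD.toC.toK.layer.s Y, ∀ φ ∈ lamD.toC.toK.layer.sp1 Y, ∀ z ∈ ball (0 : lamD.toC.toK.layer.E) R,
      ‖lamD.toC.toK.layer.Wf Y i φ z‖ ≤ K₂ * Real.exp (-(lamD.toC.toK.layer.c.κ₁ - 1) * ((Y.1.card : ℝ) - 1)) * ‖z‖ ^ 3)
    (hcard : ∀ Y, (lamD.toC.toK.layer.s Y).card ≤ m₂ * Y.1.card)
    (hsp : ∀ Y φ, φ ∈ lamD.toC.toK.layer.sp1 Y → ‖lamD.toC.toK.layer.g‖ * ‖lamD.toC.toK.layer.rd Y φ‖ < lamD.toC.toK.layer.c.ε₁)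
    (hfloor : 27 * m₂ * K₂ * Real.exp (lamD.toC.toK.layer.c.κ₁ - 1) ≤ lamD.toC.toK.layer.c.C₃ * lamD.toC.toK.layer.c.M ^ 4 * Real.exp (lamD.toC.toK.layer.c.C₂ * lamD.toC.toK.layer.c.κ₁))
    (hAnP : ∀ Y, ∀ i ∈ lamD.toC.toK.layer.s Y, AnalyticOnNhd ℂ (fun φ => scaled lamD.toC.toK.layer.g (lamD.toC.toK.layer.Wf Y i φ) (lamD.toC.toK.layer.rd Y φ)) (lamD.toC.toK.layer.sp1 Y))
    (hG : ∀ Y, lamD.toC.toK.layer.GaugeInv (lamD.toC.toK.layer.V Y) ∧ lamD.toC.toK.layer.GaugeInv ((WtOfRecord θ lamD.toC.toK.layer).toStepData.quadForm Y) ∧ lamD.toC.toK.layer.GaugeInv (lamD.toC.toK.layer.Vpp Y))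
    -- (3) LEMMA 3 (pp. 14–20): the signs of (2.18)–(2.20), R12, |τ(Y)| ≥ 2, and the numerics bundle at ℓ = ½L
    (hL8 : 8 ≤ θ.ℓ₆ + 1) {a a₂ a₂' a₅ Aabs : ℝ}
    (hN : Lemma3Numerics (c13OfRecord θ lamD.toC.toK.layer) (lamD.toC.toK.layer.m₃ + 1) (((θ.ℓ₆ + 1 : ℕ) : ℝ) / 2) a a₂ a₂' a₅ Aabs)
    (h12 : R12 (c13OfRecord θ lamD.toC.toK.layer)) (hE : 0 < lamD.toC.toK.layer.c.E₀) (hε : 0 < lamD.toC.toK.layer.c.ε₁)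
    (hC₁ : 0 < lamD.toC.toK.layer.c.C₁) (hα : 0 < lamD.toC.toK.layer.c.α₄) (hM : 1 ≤ lamD.toC.toK.layer.c.M)
    (hτ2 : lamD.toC.toK.layer.c.E₀ * lamD.toC.toK.layer.c.ε₁ * lamD.toC.toK.layer.c.C₁ * lamD.toC.toK.layer.c.α₄⁻¹ * lamD.toC.toK.layer.c.M ^ lamD.toC.toK.layer.c.q * Real.exp (lamD.toC.toK.layer.c.C₂ * lamD.toC.toK.layer.c.κ₁) ≤ 1 / 2)
    -- (3) the Cauchy radius and the parameter domains (p. 15)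
    -- the bigger σ-polydisc (a second constants record `cp` lending its `κ₁`; NODE A's kernels are tagged at `cp`) and a
    -- Cauchy radius `r ≤ 1`; the τ-regions are the open discs of radii `2|τ(Y)|` (chosen inside)
    (cp : B13.Consts) (hκp : lamD.toC.toK.layer.c.κ₁ < cp.κ₁) (hr : 0 < lamD.toC.toK.r) (hr1 : lamD.toC.toK.r ≤ 1)
    -- (3) THE DICTIONARY IS def-B13's KERNEL TOWER (`lamD.toC.toK.𝒦 ∕ uOf ∕ r ∕ lZ ∕ lD ∕ Gam ∕ chiY₀ ∕ chicP ∕ Pl ∕ rP ∕ Vr ∕ emb`, `Dfam := 𝐃`; `Γ(σ) = G(σ)·` is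
    --     `ResidB13K.Gam_eq`): only the configuration size `α` and the `|P|` row-bond count stay located
    {α : ℝ} (hαnn : 0 ≤ α)
    (huα : ∀ Z, ∀ t ∈ terms (θ.ℓ₆ + 1) (lamD.toC.toK.layer.m₃ + 1) Z, ∀ φ ∈ lamD.toC.toK.layer.sp2 Z, ‖lamD.toC.toK.uOf Z t φ‖ ≤ α)
    (hPcard : ∀ Z, ∀ t ∈ terms (θ.ℓ₆ + 1) (lamD.toC.toK.layer.m₃ + 1) Z, (lamD.toC.toK.Pl Z t).card = t.2.card)
    -- (3) the record's objects behind the terms: bonds, cubes, the real field inside the configurations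
    (ιb : (Z : TDom 4 (lamD.toC.toK.layer.n + 1)) → (t : Finset (TDom 4 ((θ.ℓ₆ + 1) * (lamD.toC.toK.layer.n + 1))) × Finset (TBond 4 (lamD.toC.toK.layer.m₃ + 1) ((θ.ℓ₆ + 1) * (lamD.toC.toK.layer.n + 1)))) → (lamD.toC.toK.𝒦 Z t).Λ → lamD.toC.toK.layer.Bond)
    (hι : ∀ Z t, Function.Injective (ιb Z t)) (cube : lamD.toC.toK.layer.Bond → TPt 4 ((θ.ℓ₆ + 1) * (lamD.toC.toK.layer.n + 1)))
    (hQsupp : ∀ (Y : TDom 4 ((θ.ℓ₆ + 1) * (lamD.toC.toK.layer.n + 1))) φ b b', lamD.toC.toK.layer.Q Y φ b b' ≠ 0 → cube b ∈ Y.1 ∧ cube b' ∈ Y.1) {m' : ℕ}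
    (hfibc : ∀ Z t (x : TPt 4 ((θ.ℓ₆ + 1) * (lamD.toC.toK.layer.n + 1))), (Finset.univ.filter fun j => cube (ιb Z t j) = x).card ≤ m')
    (hBv : ∀ Z t φ B b, lamD.toC.toK.layer.Bv (lamD.toC.toK.emb Z t φ B) (ιb Z t b) = (B b : ℂ))
    (hBv0 : ∀ Z t φ B b', b' ∉ Set.range (ιb Z t) → lamD.toC.toK.layer.Bv (lamD.toC.toK.emb Z t φ B) b' = 0)
    (hχsupp : ∀ Z, ∀ t ∈ terms (θ.ℓ₆ + 1) (lamD.toC.toK.layer.m₃ + 1) Z, ∀ φ ∈ lamD.toC.toK.layer.sp2 Z, ∀ B, lamD.toC.toK.chiY₀ Z t B ≠ 0 → ∀ Y ∈ t.1,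
      lamD.toC.toK.emb Z t φ B ∈ lamD.toC.toK.layer.sp1 Y)
    -- (3) measurability of the layer's potentials and small-field region in the bond variables (`χ_{k,Y₀}` of record IS measurable, §0)
    (hVm : ∀ Z t φ Y, Measurable (lamD.toC.toK.Vr Z t φ Y))
    (hsmallm : ∀ Z t φ, MeasurableSet {B : (lamD.toC.toK.𝒦 Z t).Λ → ℝ | ∀ Y ∈ t.1, lamD.toC.toK.emb Z t φ B ∈ lamD.toC.toK.layer.sp1 Y}) {γ₂ : ℝ}
    (hγ₂ : 0 ≤ γ₂)
    -- (3) uniform fibre bounds of the bond locations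
    {m : ℕ} (hfibN : ∀ Z t (x : UT lamD.toC.toK.Nf), (Finset.univ.filter fun j => (lamD.toC.toK.𝒦 Z t).locN j = x).card ≤ m)
    -- (3) THE REFERENCE RUNG ON THE TERMS OF THE STEP OF RECORD (the displayed hypothesis, n10-b's reference currency):
    --     ONE admissible reference package `rf`, an accretivity radius `0 < R₁ < R`, print's two perturbative sources (p. 15:
    --     «O(1)e^{−⅓δ₀M} + O(α₀ + α₁)» against the reference positivity) as FOUR DIVISION-FREE THRESHOLDS, positive input
    --     rates and `η ≤ etaMax` of the W-walks package `rf.toWalkPackage R₁` (standard rate book: `κ_C = κ_C⋆`, `ρ′ = μ∕4`),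
    --     `TermWalksRef` for the kernels of every term, round letters, and PRINT's TWO EXCHANGE THRESHOLDS for a `θ₀ > 0`
    (rf : RefPackage) (hrf : rf.Admissible)
    -- (2″) THE RUNG's TWO DIALS AS n10-w3's LOCATED NUMERALS (`B13RungDialNumerals`): the accretivity radius IS `R₁⋆(rf)` and the exchange
    --      letter IS `θ₀max` (n10-w1) — stated as EQUATION binders (discharge by `rfl`) so that the package numerals stay short
    {R₁ : ℝ} (hR₁def : R₁ = radiusStar rf.R rf.m₀ rf.mA₀ rf.KbarP rf.KbarA rf.cV rf.cV₀)
    (hp : (rf.toWalkPackage R₁).PositiveRates) (hη : rf.η ≤ (rf.toWalkPackage R₁).etaMax)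
    {θ₀ : ℝ} (hθ₀def : θ₀ = theta0Max m lamD.toC.toK.ν (rf.toWalkPackage R₁).kapCStar (rf.toWalkPackage R₁).Kbar (8 / rf.mA₀) (2 / rf.mA₀)
      (rf.toWalkPackage R₁).BΓ rf.cV (B6.c0 1 rf.η) rf.mA₀)
    -- (2″) PRINT's TWO PERTURBATIVE SOURCES AS TWO LOCATED INEQUALITIES: «|A′|, |𝐉| small» ([II] p. 15) and «σ-cubes far from Z₀» (p. 13)
    (hαloc : α ≤ alphaMax θ₀ R₁ (rf.toWalkPackage R₁).Kbar)
    (hRσloc : rsigmaMin θ₀ (rf.toWalkPackage R₁).Kbar (rf.toWalkPackage R₁).mu (rf.toWalkPackage R₁).kapCStar rf.m₀ rf.mA₀ rf.KbarP rf.KbarA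
      rf.cV rf.cV₀ rf.εP rf.εA ≤ rf.Rσ)
    -- (3) NODE A's KERNEL DATA READ OFF ONE OPERATOR PER TERM — print's `C*Δ_k(σ(Z),𝐔,𝐉)C` after the conditioning (2.5)–(2.6): block
    --     reading; ONE expansion at `rf`'s full-precision letters whose terms are `s`-MONOMIALS times σ-free operators ([II] p. 3) and
    --     carry a WALK REVERSAL ([13] (3.107)); ONE positivity; geometry; dominations in `rf`
    (hKX : ∀ Z, ∀ t ∈ terms (θ.ℓ₆ + 1) (lamD.toC.toK.layer.m₃ + 1) Z, (lamD.toC.toK.𝒦 Z t).X.Nonempty)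
    -- (3″) NODE A's OBJECT DATA AS ENTRYWISE LETTERS (census v5 class A2′ in its ENTRYWISE form ∧ A2″ as ONE geometric letter ∧ A2‴; replaces
    --      module 21's `hKexp`; ym-nodeO-ideate P2 g30's reduction, tree module `B13EntrywiseWalks`): per term, the fine-bond index `lamD.P Z t` located by
    --      `locF`; TWO ENTRYWISE LETTERS of the σ-free fluctuation operator `lamD.Δ₀ Z t` on the complex `rf.R`-ball — (3.108)-type decay
    --      `‖Δ₀(u)_{ij}‖ ≤ B·e^{−ρ·d₁(i,j)}` and entrywise holomorphy (`RawEntryLetters`) —, a fibre bound; the cube decoration `J` on PAIRS of fine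
    --      bonds with the GEODESIC letter (`|J(i,j)| ≤ c₀ + d₁(i,j)∕M₁`, a decorated pair joined by a `d₁`-geodesic through `(lamD.toC.toK.𝒦 Z t).X`); the (1.11)
    --      numerics `0 < η ≤ ε < ρ`, `2κ₁ ≤ ηM₁`; the REAL constant local averaging operator `lamD.Cm Z t` of (2.5) (`|C| ≤ 1`, range `rC`); a junction
    --      rate `μΔ`; the letter match with `rf`; and `lamD.toC.KK Z t` IS `Cᵀ·sDecorate(J′, ½raw ⊕ ½rawᵀ)·C` (`hKK`)
    {ρΔ BΔ ηΔ μΔ M₁ rC : ℝ} {mF c₀ : ℕ}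
    (hEL : ∀ Z, ∀ t ∈ terms (θ.ℓ₆ + 1) (lamD.toC.toK.layer.m₃ + 1) Z, RawEntryLetters (lamD.Δ₀ Z t) (lamD.locF Z t) rf.R ρΔ BΔ)
    (hfibF : ∀ Z t (y : UT lamD.toC.toK.Nf), (Finset.univ.filter fun k => lamD.locF Z t k = y).card ≤ mF)
    (hGJ : ∀ Z, ∀ t ∈ terms (θ.ℓ₆ + 1) (lamD.toC.toK.layer.m₃ + 1) Z, GeodesicDecoration (lamD.J Z t) (lamD.locF Z t) (lamD.toC.toK.𝒦 Z t).X c₀ M₁)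
    (hηΔ : 0 < ηΔ) (hP2 : 2 * cp.κ₁ ≤ ηΔ * M₁) (hCle : ∀ Z t k i, |lamD.Cm Z t k i| ≤ 1)
    (hCsupp : ∀ Z t k i, lamD.Cm Z t k i ≠ 0 → tdist1 lamD.toC.toK.Nf (lamD.locF Z t k) ((lamD.toC.toK.𝒦 Z t).locN i) ≤ rC) (hμΔ : 0 < μΔ)
    -- (3″) THE (1.11) NUMERICS + JUNCTION-RATE CHAIN AS n10-w3's LOCATED NUMERALS (`B13EntrywiseBlockNumerals`, dial form):
    --      ONE rate budget and ONE floor replace `εΔ κΔ hηε hρε hμε hμκ hκεΔ hεP hkapP hKP`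
    (hbudget : ηΔ + rf.εP + rf.kapP + 4 * μΔ ≤ ρΔ)
    (hkbar : kbarFloor lamD.toC.toK.ν mF c₀ ρΔ ηΔ μΔ rC cp.κ₁ BΔ ≤ rf.KbarP)
    (hKacc : ∀ Z, ∀ t ∈ terms (θ.ℓ₆ + 1) (lamD.toC.toK.layer.m₃ + 1) Z, ∀ v : (lamD.toC.toK.𝒦 Z t).Λ ⊕ (lamD.toC.toK.𝒦 Z t).C₀ → ℂ,
      rf.m₀ * ∑ i, ‖v i‖ ^ 2 ≤ (∑ i, star (v i) * (lamD.toC.KK Z t 0 0 *ᵥ v) i).re)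
    (hKfar : ∀ Z, ∀ t ∈ terms (θ.ℓ₆ + 1) (lamD.toC.toK.layer.m₃ + 1) Z, ∀ k, ∀ z ∈ (lamD.toC.toK.𝒦 Z t).X, rf.Rσ ≤ tdist1 lamD.toC.toK.Nf ((lamD.toC.toK.𝒦 Z t).locN k) z)
    (hKmult : ∀ Z, ∀ t ∈ terms (θ.ℓ₆ + 1) (lamD.toC.toK.layer.m₃ + 1) Z, ∀ x : UT lamD.toC.toK.Nf,
      (Finset.univ.filter fun k => (lamD.toC.toK.𝒦 Z t).locN k = x).card ≤ rf.nB)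
    (hKdim : lamD.toC.toK.ν ≤ rf.dm) (hεL : rf.εL ≤ rf.εP) (hκL : rf.kapL ≤ rf.kapP) (hKL : rf.KbarP ≤ rf.KbarL) (hεA : rf.εA ≤ rf.εP)
    (hκA : rf.kapA ≤ rf.kapP) (hKA : rf.KbarP ≤ rf.KbarA) (hmA : rf.mA₀ ≤ rf.m₀)
    -- (3) THE (2.24)–(2.25) SMALLNESS AS n10-w1's THREE LOCATED NUMERALS (`B13Bound226Numerals`: canonical rate chain `j·κ_C⋆∕5`,
    --     `ϑ := theta`, `K_G := K̄`, `K_Cs := 8∕m_{A,0}`, `c_E := 2∕m_{A,0}`): `θ₀ ≤ θ₀max`, `γ₂ ≤ γ₂max`, `M⁴min ≤ M⁴`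
    (hγle : γ₂ ≤ gamma2Max m lamD.toC.toK.ν (2 / rf.mA₀) (rf.toWalkPackage R₁).BΓ rf.cV (B6.c0 1 rf.η) rf.mA₀)
    (hM4 : m4Min m lamD.toC.toK.ν m' (2 / rf.mA₀) (rf.toWalkPackage R₁).BΓ rf.cV (B6.c0 1 rf.η) rf.mA₀ lamD.toC.toK.layer.c.α₄ lamD.toC.toK.layer.c.κ₁ ≤ lamD.toC.toK.layer.c.M ^ 4)
    -- (3) constant matching, p. 17: `a ≤ γ₂ r_P²` and the volume factor with `w = 2·K₀(64,8)·α₄·#(⋃𝐃)`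
    (hPa : a ≤ γ₂ * lamD.toC.toK.rP ^ 2)
    -- (3) the volume factor in θ-FREE COUNT FORM (`B13Bound226Numerals.vol_of_counts`): `2|Λ| + ½|Λ ⊕ C₀| + 2K₀(64,8)α₄·#⋃𝐃 ≤ a₅|Z|`
    (hcount : ∀ Z, ∀ t ∈ terms (θ.ℓ₆ + 1) (lamD.toC.toK.layer.m₃ + 1) Z,
      2 * (Fintype.card (lamD.toC.toK.𝒦 Z t).Λ : ℝ) + (Fintype.card ((lamD.toC.toK.𝒦 Z t).Λ ⊕ (lamD.toC.toK.𝒦 Z t).C₀) : ℝ) / 2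
        + 2 * (K₀ 64 8 * lamD.toC.toK.layer.c.α₄ * ((((t.1).image Subtype.val).biUnion id).card : ℝ)) ≤ a₅ * ((Z.1).card : ℝ)) :
    B13LeafOfRecord θ lamD.toC.toK.layer := by
  -- the package at the located radius is admissible; its numerals are signed; `θ₀max` is a legitimate exchange letter (`0 < θ₀max ≤ 1 < 4K̄+4`)
  have hR₁pos : 0 < R₁ := hR₁def ▸ radiusStar_pos hrf.hR hrf.hm₀ hrf.hmA₀ hrf.hKbarP hrf.hKbarA (cV_nonneg hrf) (cV₀_nonneg hrf)
  have hq := admissible_toWalkPackage hrf hR₁pos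
  have hκs : 0 < (rf.toWalkPackage R₁).kapCStar := (kapCStar_spec hq (rhoE_pos hp) (mu_pos hq hp)).1
  have hKbar : 0 ≤ (rf.toWalkPackage R₁).Kbar := Kbar_nonneg hq
  have hmA0 : 0 < rf.mA₀ := hrf.hmA₀
  have hθpos : 0 < θ₀ := hθ₀def ▸ theta0Max_pos m lamD.toC.toK.ν hκs (div_nonneg (by norm_num) hmA0.le) (div_nonneg (by norm_num) hmA0.le) (cV_nonneg hrf)
    (RefPackage.c0_nonneg hrf.hη) hmA0
  have hθ1 : θ₀ ≤ 1 := by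
    rw [hθ₀def]; unfold theta0Max
    have hQ := coefQ_nonneg m lamD.toC.toK.ν (κs := (rf.toWalkPackage R₁).kapCStar) (KG := (rf.toWalkPackage R₁).Kbar)
      (div_nonneg (by norm_num : (0:ℝ) ≤ 8) hmA0.le)
    have hQ' := coefQ'_nonneg m lamD.toC.toK.ν (KG := (rf.toWalkPackage R₁).Kbar) (KCs := 8 / rf.mA₀) hκs
    have hD := (dSum_pos_and_le m lamD.toC.toK.ν (BΓ := (rf.toWalkPackage R₁).BΓ) (div_nonneg (by norm_num : (0:ℝ) ≤ 2) hmA0.le) (cV_nonneg hrf)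
      (RefPackage.c0_nonneg hrf.hη) hmA0).1
    exact div_le_one_of_le₀ (by nlinarith [mul_nonneg hD.le hQ']) (by positivity)
  have hθ4 : θ₀ < 4 * (rf.toWalkPackage R₁).Kbar + 4 := by linarith
  -- the nine dial binders of 67R at `R₁⋆`, `θ₀max` from the two located inequalities (`B13RungDialNumerals.rung_dials_at`)
  have hd := rung_dials_at (mu := (rf.toWalkPackage R₁).mu) (kapC := (rf.toWalkPackage R₁).kapCStar) hrf.hR hrf.hm₀ hmA0 hrf.hKbarP hrf.hKbarA
    (cV_nonneg hrf) (cV₀_nonneg hrf) hp.hεP hp.hεA hKbar hθ4 (hR₁def ▸ hαloc) hRσloc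
  rw [← hR₁def] at hd
  exact b13LeafOfRecord_decLayer_of_located_entrywise_numerals_rates θ lamD
    hN12 dist hS0Y hFsub hSq hScY hdist0 hdist hSX hSX' hX0 hAnT hAnT' hK hK' hκ hδ1 hδκ hκ126 hκ126' hκ₁ hκ₁' hδ₀M hδ₀M5 hR8 hR9 h124 h130 hθ₁0 hθ₁1
    hC hGlAn hGl he hg hK₂ hR hε3 hW hKW hcard hsp hfloor hAnP hG hL8 hN h12 hE hε hC₁ hα hM hτ2 cp hκp hr hr1 hαnn huα hPcard ιb hι cube hQsupp
    hfibc hBv hBv0 hχsupp hVm hsmallm hγ₂ hfibN rf hrf hd.1 hd.2.1 hd.2.2.1 hd.2.2.2.1 hd.2.2.2.2.1 hd.2.2.2.2.2.1 hp hη hd.2.2.2.2.2.2.1 hKX hEL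
    hfibF hGJ hηΔ hP2 hCle hCsupp hμΔ hbudget hkbar hKacc hKfar hKmult hKdim hεL hκL hKL hεA hκA hKA hmA hθpos hd.2.2.2.2.2.2.2.1 hd.2.2.2.2.2.2.2.2
    hθ₀def.le hγle hM4 hPa hcount

end DecLayer

end Summit.QuantumFields.YangMills.BalabanUVNodes.N10B13KernelTowerWalksEntrywiseNumeralsDecoratedDials

end
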